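import Summits.ResolutionOfSingularities.ResolutionOfSingularities.Theorems.FrobeniusLadderFInjectiveMacaulayficationRoadBFrame
import Summits.ResolutionOfSingularities.ResolutionOfSingularities.Theorems.FrobeniusLadderFInjectiveMacaulayficationT11Char7FanData
import Summits.ResolutionOfSingularities.ResolutionOfSingularities.Theorems.FrobeniusLadderFInjectiveMacaulayficationT11Char7Poly
import Summits.ResolutionOfSingularities.ResolutionOfSingularities.Theorems.FrobeniusLadderFInjectiveMacaulayficationT11Char5Cells00
import Summits.ResolutionOfSingularities.ResolutionOfSingularities.Theorems.FrobeniusLadderFInjectiveMacaulayficationT11Char5Cells01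
import Summits.ResolutionOfSingularities.ResolutionOfSingularities.Theorems.FrobeniusLadderFInjectiveMacaulayficationT11Char5Cells02
import Summits.ResolutionOfSingularities.ResolutionOfSingularities.Theorems.FrobeniusLadderFInjectiveMacaulayficationT11Char5Cells03
import Summits.ResolutionOfSingularities.ResolutionOfSingularities.Theorems.FrobeniusLadderFInjectiveMacaulayficationT11Char5Cells04
import Summits.ResolutionOfSingularities.ResolutionOfSingularities.Theorems.FrobeniusLadderFInjectiveMacaulayficationT11Char5Cells05
import Summits.ResolutionOfSingularities.ResolutionOfSingularities.Theorems.FrobeniusLadderFInjectiveMacaulayficationT11Char5Cells06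
import Summits.ResolutionOfSingularities.ResolutionOfSingularities.Theorems.FrobeniusLadderFInjectiveMacaulayficationT11Char5Cells07
import Summits.ResolutionOfSingularities.ResolutionOfSingularities.Theorems.FrobeniusLadderFInjectiveMacaulayficationT11Char5Cells08
import Summits.ResolutionOfSingularities.ResolutionOfSingularities.Theorems.FrobeniusLadderFInjectiveMacaulayficationT11Char5Cells09
import Summits.ResolutionOfSingularities.ResolutionOfSingularities.Theorems.FrobeniusLadderFInjectiveMacaulayficationT11Char5Cells10
import Summits.ResolutionOfSingularities.ResolutionOfSingularities.Theorems.FrobeniusLadderFInjectiveMacaulayficationT11Char5Cells11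
import Summits.ResolutionOfSingularities.ResolutionOfSingularities.Theorems.FrobeniusLadderFInjectiveMacaulayficationT11Char5Cells12
import Summits.ResolutionOfSingularities.ResolutionOfSingularities.Theorems.FrobeniusLadderFInjectiveMacaulayficationT11Char5Cells13
import Summits.ResolutionOfSingularities.ResolutionOfSingularities.Theorems.FrobeniusLadderFInjectiveMacaulayficationT11Char5Cells14
import Summits.ResolutionOfSingularities.ResolutionOfSingularities.Theorems.FrobeniusLadderFInjectiveMacaulayficationT11Char5Cells15
import Summits.ResolutionOfSingularities.ResolutionOfSingularities.Theorems.FrobeniusLadderFInjectiveMacaulayficationT11Char5Cells16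
import Summits.ResolutionOfSingularities.ResolutionOfSingularities.Theorems.FrobeniusLadderFInjectiveMacaulayficationT11Char5Cells17
import Summits.ResolutionOfSingularities.ResolutionOfSingularities.Theorems.FrobeniusLadderFInjectiveMacaulayficationT11HypersurfacePrime
import Summits.ResolutionOfSingularities.ResolutionOfSingularities.Theorems.FrobeniusLadderFInjectiveMacaulayficationT11SpecimenDoorGeneric
import Summits.ResolutionOfSingularities.ResolutionOfSingularities.Theorems.FrobeniusLadderFInjectiveMacaulayficationT11Char5Poly
import Summits.ResolutionOfSingularities.ResolutionOfSingularities.Theorems.FrobeniusLadderFInjectiveMacaulayficationT11PlusOriginTransportStalk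
import HarnessLib

/-!
# THE ROAD-B INSTANCE `T₁₁ / 5`: the origin of `X = V(z² + (y²+x³)³ + x¹¹ + w⁷) ⊂ 𝔸⁴_k`, `char k = 5`, is POINT-FIXABLE — and the crux statement
# for `T₁₁⁺` over every field of characteristic `5`, unconditional
# (crux `FInjectiveMacaulayfication`, road B, instance-ledger I13 = the T₁₁/5 twin; res-L1-w45a-plan-1 GO 2026-08-27T10:42:50Z; seat res-L1-w45a-stub-2)

Support file for crux stmt-ResolutionOfSingularities-15315 (`FrobeniusLadder.FInjectiveMacaulayfication`), chain w45a. [OURS · L1 W4.5a] —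
NOT a statement of the manuscript [claim: Hironaka2017]; AI-written, weaker than expert review; no statement of the manuscript is used.

The `p = 5` twin of res-L1-w45a-stub-1's `T11OriginPointFixableChar7` (p525959), SAME FRAME, SAME FAN: `t11_originPointFixable_char5` =
`RoadBFrame.originPointFixable_of_cells` (p = 5, n = 4, t = 87) applied BY NAME to the p-independent road-B data of res-L1-w45a-tri-1's toric
certificate (`cert-T11-own-p5.v1.1.json` sha16 `773788e74f35402a` has the same fan, charts, `g`, `V`, `d` as the p = 7 certificate `f223877b5f992ee0`
— REUSE AUDIT 2026-08-27T10:56:49Z): fan tables and binders `T11Char7Fan.*` (res-L1-w45a-stub-3), `T11Char7Poly.{G, SS, hθF₀, hSScov}` (stub-5),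
the `p = 5` siblings `T11Char5Poly.{hg0, hX}` (this seat), and the 87 per-chart CELL PACKAGES AT `p = 5` `T11Char5Cells<NN>.chart<c>_cells` (this
seat's generator `gen_kloc_t11_p5.py`, a p := 5 copy of res-D-pv-040's; 161 `const` + 78 `empty` strata + ONE `gb-unit-lift` stratum — chart 64,
S = {2}, cofactors from tri-1's `gbcells-T11p5-T4p7.v1.1.json`, encoded order-blind; one `decide +kernel` each through res-L1-w45a-stub-6's
`KLocCellKit.klocCells_of_check`). Conclusion in the `h0` shape of the specimen door at `p = 5`,
`T11SpecimenDoorGeneric.fInjectiveMacaulayfication_T11plus_char5_of_h0` (this seat; `T₁₁⁺` is regular off the origin in characteristic 5), reached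
through the stalk transport `T11PlusOriginTransportStalk.t11Plus_h0_of_hypersurface_h0 (p := 5)` (I11).

* `cells_transport`, `cells_all` — the 87 cell packages at `p = 5` over the tables;
* `t11_originPointFixable_char5 (Gs) (hG : Gs 0 = T₁₁)` — `∀ b : Spec (k[x,y,z,w]/(Gs)), b = origin → PFix₅(𝒪_{X,b})`;
* `fInjectiveMacaulayfication_T11plus_char5` — **THE SECOND UNCONDITIONAL PRIME FOR THE DECIDING SPECIMEN**: the crux statement for
  `X = T₁₁⁺ ⊂ 𝔸⁵_k`, every field `k` of characteristic `5` (door₅ ∘ stalk transport ∘ frame).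

No definitions, no named facts. [folklore glue; the mathematics is the certificate]
-/


-- single-problem summit: the doubled namespace component is forced
set_option linter.dupNamespace false

noncomputable section

open AlgebraicGeometry MvPolynomial

namespace Summit.ResolutionOfSingularities.ResolutionOfSingularities.Theorems.FInjectiveMacaulayfication.T11OriginPointFixableChar5

open Summit.ResolutionOfSingularities.ResolutionOfSingularities.Theorems.FInjectiveMacaulayfication

/-- Transport of one chart's cell package from the generated literals (strata list `SS₁`, term list `G₁`) to the tables
(`SS₂ = T11Char7Poly.SS c`, `G₂ = T11Char7Poly.G c`): the strata lists are EQUAL and the term lists are PERMUTATIONS of each other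
(two generated text sets, key-sorted and JSON order — res-L1-w45a-plan-1 R12.44); both side conditions are decided in the kernel, so
the elaborator never unfolds the 87-entry tables. [folklore] -/
theorem cells_transport (k : Type) [Field k] {SS₁ SS₂ : List (Finset (Fin 4))} {G₁ G₂ : List (ℤ × (Fin 4 → ℕ))}
    (hS : SS₁ = SS₂) (hG : G₁.Perm G₂)
    (h : ∀ S ∈ SS₁, ∃ (L : List ((Fin 4 →₀ ℕ) × MvPolynomial (Fin 4) k)) (rr : List (MvPolynomial (Fin 4) k))
      (tt : Fin 4 → MvPolynomial (Fin 4) k) (t₀ : MvPolynomial (Fin 4) k),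
      (L.map Prod.fst).Nodup ∧ (∀ e ∈ L, ∀ i : Fin 4, e.1 i < 5) ∧
      KLocCellKit.evalL k G₁ ^ (5 - 1) = (L.map fun e => MvPolynomial.monomial e.1 (1 : k) * MvPolynomial.expand 5 e.2).sum ∧
      (1 : MvPolynomial (Fin 4) k) = (List.zipWith (fun r e => r * MvPolynomial.expand 5 e.2) rr L).sum +
        ∑ i ∈ S, tt i * MvPolynomial.X i + t₀ * KLocCellKit.evalL k G₁) :
    ∀ S ∈ SS₂, ∃ (L : List ((Fin 4 →₀ ℕ) × MvPolynomial (Fin 4) k)) (rr : List (MvPolynomial (Fin 4) k))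
      (tt : Fin 4 → MvPolynomial (Fin 4) k) (t₀ : MvPolynomial (Fin 4) k),
      (L.map Prod.fst).Nodup ∧ (∀ e ∈ L, ∀ i : Fin 4, e.1 i < 5) ∧
      KLocCellKit.evalL k G₂ ^ (5 - 1) = (L.map fun e => MvPolynomial.monomial e.1 (1 : k) * MvPolynomial.expand 5 e.2).sum ∧
      (1 : MvPolynomial (Fin 4) k) = (List.zipWith (fun r e => r * MvPolynomial.expand 5 e.2) rr L).sum +
        ∑ i ∈ S, tt i * MvPolynomial.X i + t₀ * KLocCellKit.evalL k G₂ := by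
  subst hS
  exact RoadBFrame.cells_of_perm 5 k _ hG h


/-- The 87 cell packages, collected over `c : Fin 87` against the tables `T11Char7Poly.G` / `T11Char7Poly.SS` (each entry is the
generated theorem `T11Char5Cells<NN>.chart<c>_cells`, whose literal `G`/strata lists ARE the table entries — tri-1 JSON order). -/
theorem cells_all (k : Type) [Field k] [CharP k 5] : ∀ (c : Fin 87), ∀ S ∈ T11Char7Poly.SS c,
    ∃ (L : List ((Fin 4 →₀ ℕ) × MvPolynomial (Fin 4) k)) (rr : List (MvPolynomial (Fin 4) k))
      (tt : Fin 4 → MvPolynomial (Fin 4) k) (t₀ : MvPolynomial (Fin 4) k),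
      (L.map Prod.fst).Nodup ∧ (∀ e ∈ L, ∀ i : Fin 4, e.1 i < 5) ∧
      KLocCellKit.evalL k (T11Char7Poly.G c) ^ (5 - 1) = (L.map fun e => MvPolynomial.monomial e.1 (1 : k) * MvPolynomial.expand 5 e.2).sum ∧
      (1 : MvPolynomial (Fin 4) k) = (List.zipWith (fun r e => r * MvPolynomial.expand 5 e.2) rr L).sum +
        ∑ i ∈ S, tt i * MvPolynomial.X i + t₀ * KLocCellKit.evalL k (T11Char7Poly.G c) := by
  intro c
  fin_cases c
  · exact cells_transport k (by decide +kernel) (by decide +kernel) (T11Char5Cells00.chart0_cells k)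
  · exact cells_transport k (by decide +kernel) (by decide +kernel) (T11Char5Cells00.chart1_cells k)
  · exact cells_transport k (by decide +kernel) (by decide +kernel) (T11Char5Cells00.chart2_cells k)
  · exact cells_transport k (by decide +kernel) (by decide +kernel) (T11Char5Cells00.chart3_cells k)
  · exact cells_transport k (by decide +kernel) (by decide +kernel) (T11Char5Cells00.chart4_cells k)
  · exact cells_transport k (by decide +kernel) (by decide +kernel) (T11Char5Cells01.chart5_cells k)
  · exact cells_transport k (by decide +kernel) (by decide +kernel) (T11Char5Cells01.chart6_cells k)
  · exact cells_transport k (by decide +kernel) (by decide +kernel) (T11Char5Cells01.chart7_cells k)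
  · exact cells_transport k (by decide +kernel) (by decide +kernel) (T11Char5Cells01.chart8_cells k)
  · exact cells_transport k (by decide +kernel) (by decide +kernel) (T11Char5Cells01.chart9_cells k)
  · exact cells_transport k (by decide +kernel) (by decide +kernel) (T11Char5Cells02.chart10_cells k)
  · exact cells_transport k (by decide +kernel) (by decide +kernel) (T11Char5Cells02.chart11_cells k)
  · exact cells_transport k (by decide +kernel) (by decide +kernel) (T11Char5Cells02.chart12_cells k)
  · exact cells_transport k (by decide +kernel) (by decide +kernel) (T11Char5Cells02.chart13_cells k)
  · exact cells_transport k (by decide +kernel) (by decide +kernel) (T11Char5Cells02.chart14_cells k)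
  · exact cells_transport k (by decide +kernel) (by decide +kernel) (T11Char5Cells03.chart15_cells k)
  · exact cells_transport k (by decide +kernel) (by decide +kernel) (T11Char5Cells03.chart16_cells k)
  · exact cells_transport k (by decide +kernel) (by decide +kernel) (T11Char5Cells03.chart17_cells k)
  · exact cells_transport k (by decide +kernel) (by decide +kernel) (T11Char5Cells03.chart18_cells k)
  · exact cells_transport k (by decide +kernel) (by decide +kernel) (T11Char5Cells03.chart19_cells k)
  · exact cells_transport k (by decide +kernel) (by decide +kernel) (T11Char5Cells04.chart20_cells k)
  · exact cells_transport k (by decide +kernel) (by decide +kernel) (T11Char5Cells04.chart21_cells k)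
  · exact cells_transport k (by decide +kernel) (by decide +kernel) (T11Char5Cells04.chart22_cells k)
  · exact cells_transport k (by decide +kernel) (by decide +kernel) (T11Char5Cells04.chart23_cells k)
  · exact cells_transport k (by decide +kernel) (by decide +kernel) (T11Char5Cells04.chart24_cells k)
  · exact cells_transport k (by decide +kernel) (by decide +kernel) (T11Char5Cells05.chart25_cells k)
  · exact cells_transport k (by decide +kernel) (by decide +kernel) (T11Char5Cells05.chart26_cells k)
  · exact cells_transport k (by decide +kernel) (by decide +kernel) (T11Char5Cells05.chart27_cells k)
  · exact cells_transport k (by decide +kernel) (by decide +kernel) (T11Char5Cells05.chart28_cells k)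
  · exact cells_transport k (by decide +kernel) (by decide +kernel) (T11Char5Cells05.chart29_cells k)
  · exact cells_transport k (by decide +kernel) (by decide +kernel) (T11Char5Cells06.chart30_cells k)
  · exact cells_transport k (by decide +kernel) (by decide +kernel) (T11Char5Cells06.chart31_cells k)
  · exact cells_transport k (by decide +kernel) (by decide +kernel) (T11Char5Cells06.chart32_cells k)
  · exact cells_transport k (by decide +kernel) (by decide +kernel) (T11Char5Cells06.chart33_cells k)
  · exact cells_transport k (by decide +kernel) (by decide +kernel) (T11Char5Cells06.chart34_cells k)
  · exact cells_transport k (by decide +kernel) (by decide +kernel) (T11Char5Cells07.chart35_cells k)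
  · exact cells_transport k (by decide +kernel) (by decide +kernel) (T11Char5Cells07.chart36_cells k)
  · exact cells_transport k (by decide +kernel) (by decide +kernel) (T11Char5Cells07.chart37_cells k)
  · exact cells_transport k (by decide +kernel) (by decide +kernel) (T11Char5Cells07.chart38_cells k)
  · exact cells_transport k (by decide +kernel) (by decide +kernel) (T11Char5Cells07.chart39_cells k)
  · exact cells_transport k (by decide +kernel) (by decide +kernel) (T11Char5Cells08.chart40_cells k)
  · exact cells_transport k (by decide +kernel) (by decide +kernel) (T11Char5Cells08.chart41_cells k)
  · exact cells_transport k (by decide +kernel) (by decide +kernel) (T11Char5Cells08.chart42_cells k)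
  · exact cells_transport k (by decide +kernel) (by decide +kernel) (T11Char5Cells08.chart43_cells k)
  · exact cells_transport k (by decide +kernel) (by decide +kernel) (T11Char5Cells08.chart44_cells k)
  · exact cells_transport k (by decide +kernel) (by decide +kernel) (T11Char5Cells09.chart45_cells k)
  · exact cells_transport k (by decide +kernel) (by decide +kernel) (T11Char5Cells09.chart46_cells k)
  · exact cells_transport k (by decide +kernel) (by decide +kernel) (T11Char5Cells09.chart47_cells k)
  · exact cells_transport k (by decide +kernel) (by decide +kernel) (T11Char5Cells09.chart48_cells k)
  · exact cells_transport k (by decide +kernel) (by decide +kernel) (T11Char5Cells09.chart49_cells k)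
  · exact cells_transport k (by decide +kernel) (by decide +kernel) (T11Char5Cells10.chart50_cells k)
  · exact cells_transport k (by decide +kernel) (by decide +kernel) (T11Char5Cells10.chart51_cells k)
  · exact cells_transport k (by decide +kernel) (by decide +kernel) (T11Char5Cells10.chart52_cells k)
  · exact cells_transport k (by decide +kernel) (by decide +kernel) (T11Char5Cells10.chart53_cells k)
  · exact cells_transport k (by decide +kernel) (by decide +kernel) (T11Char5Cells10.chart54_cells k)
  · exact cells_transport k (by decide +kernel) (by decide +kernel) (T11Char5Cells11.chart55_cells k)
  · exact cells_transport k (by decide +kernel) (by decide +kernel) (T11Char5Cells11.chart56_cells k)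
  · exact cells_transport k (by decide +kernel) (by decide +kernel) (T11Char5Cells11.chart57_cells k)
  · exact cells_transport k (by decide +kernel) (by decide +kernel) (T11Char5Cells11.chart58_cells k)
  · exact cells_transport k (by decide +kernel) (by decide +kernel) (T11Char5Cells11.chart59_cells k)
  · exact cells_transport k (by decide +kernel) (by decide +kernel) (T11Char5Cells12.chart60_cells k)
  · exact cells_transport k (by decide +kernel) (by decide +kernel) (T11Char5Cells12.chart61_cells k)
  · exact cells_transport k (by decide +kernel) (by decide +kernel) (T11Char5Cells12.chart62_cells k)
  · exact cells_transport k (by decide +kernel) (by decide +kernel) (T11Char5Cells12.chart63_cells k)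
  · exact cells_transport k (by decide +kernel) (by decide +kernel) (T11Char5Cells12.chart64_cells k)
  · exact cells_transport k (by decide +kernel) (by decide +kernel) (T11Char5Cells13.chart65_cells k)
  · exact cells_transport k (by decide +kernel) (by decide +kernel) (T11Char5Cells13.chart66_cells k)
  · exact cells_transport k (by decide +kernel) (by decide +kernel) (T11Char5Cells13.chart67_cells k)
  · exact cells_transport k (by decide +kernel) (by decide +kernel) (T11Char5Cells13.chart68_cells k)
  · exact cells_transport k (by decide +kernel) (by decide +kernel) (T11Char5Cells13.chart69_cells k)
  · exact cells_transport k (by decide +kernel) (by decide +kernel) (T11Char5Cells14.chart70_cells k)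
  · exact cells_transport k (by decide +kernel) (by decide +kernel) (T11Char5Cells14.chart71_cells k)
  · exact cells_transport k (by decide +kernel) (by decide +kernel) (T11Char5Cells14.chart72_cells k)
  · exact cells_transport k (by decide +kernel) (by decide +kernel) (T11Char5Cells14.chart73_cells k)
  · exact cells_transport k (by decide +kernel) (by decide +kernel) (T11Char5Cells14.chart74_cells k)
  · exact cells_transport k (by decide +kernel) (by decide +kernel) (T11Char5Cells15.chart75_cells k)
  · exact cells_transport k (by decide +kernel) (by decide +kernel) (T11Char5Cells15.chart76_cells k)
  · exact cells_transport k (by decide +kernel) (by decide +kernel) (T11Char5Cells15.chart77_cells k)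
  · exact cells_transport k (by decide +kernel) (by decide +kernel) (T11Char5Cells15.chart78_cells k)
  · exact cells_transport k (by decide +kernel) (by decide +kernel) (T11Char5Cells15.chart79_cells k)
  · exact cells_transport k (by decide +kernel) (by decide +kernel) (T11Char5Cells16.chart80_cells k)
  · exact cells_transport k (by decide +kernel) (by decide +kernel) (T11Char5Cells16.chart81_cells k)
  · exact cells_transport k (by decide +kernel) (by decide +kernel) (T11Char5Cells16.chart82_cells k)
  · exact cells_transport k (by decide +kernel) (by decide +kernel) (T11Char5Cells16.chart83_cells k)
  · exact cells_transport k (by decide +kernel) (by decide +kernel) (T11Char5Cells16.chart84_cells k)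
  · exact cells_transport k (by decide +kernel) (by decide +kernel) (T11Char5Cells17.chart85_cells k)
  · exact cells_transport k (by decide +kernel) (by decide +kernel) (T11Char5Cells17.chart86_cells k)

/-- **THE ROAD-B INSTANCE `T₁₁ / 5`.** For every field `k` of characteristic `5`, the origin of the hypersurface
`X = Spec k[x,y,z,w]/(z² + (y²+x³)³ + x¹¹ + w⁷)` is point-fixable: there are finitely many elements `c` of `𝒪_{X,0}` generating an
`𝔪`-primary ideal such that every local ring of the blow-up `Bl_{(c)} 𝒪_{X,0}` over the closed point is a domain satisfying the
Cohen–Macaulay + Frobenius-closed-parameter-ideals clause of the crux (`PFix₅`, the `h0` shape of the specimen doors). Proof = the road-B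
frame on the kernel-checked toric certificate at `p = 5` (87 charts). [OURS; folklore glue] -/
theorem t11_originPointFixable_char5 (k : Type) [Field k] [CharP k 5] (Gs : Fin 1 → MvPolynomial (Fin 4) k)
    (hG : Gs 0 = X 2 ^ 2 + (X 1 ^ 2 + X 0 ^ 3) ^ 3 + X 0 ^ 11 + X 3 ^ 7) :
    ∀ b : Spec (.of (MvPolynomial (Fin 4) k ⧸ Ideal.span (Set.range Gs))),
      b.asIdeal = Ideal.span (Set.range fun j : Fin 4 => Ideal.Quotient.mk (Ideal.span (Set.range Gs)) (X j)) →
      ∃ (nc : ℕ) (c : Fin nc → (Spec (.of (MvPolynomial (Fin 4) k ⧸ Ideal.span (Set.range Gs)))).presheaf.stalk b),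
        Ideal.span (Set.range c) ≠ ⊥ ∧ (Ideal.span (Set.range c)).radical =
          IsLocalRing.maximalIdeal ((Spec (.of (MvPolynomial (Fin 4) k ⧸ Ideal.span (Set.range Gs)))).presheaf.stalk b) ∧
        ∀ (j : Fin nc) (𝔔 : PrimeSpectrum (Literature.AlgebraicGeometry.Resolution.blowupAlgebra (Ideal.span (Set.range c)) (c j))),
          𝔔.asIdeal.comap (algebraMap ((Spec (.of (MvPolynomial (Fin 4) k ⧸ Ideal.span (Set.range Gs)))).presheaf.stalk b)
            (Literature.AlgebraicGeometry.Resolution.blowupAlgebra (Ideal.span (Set.range c)) (c j))) =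
            IsLocalRing.maximalIdeal ((Spec (.of (MvPolynomial (Fin 4) k ⧸ Ideal.span (Set.range Gs)))).presheaf.stalk b) →
          IsDomain (Localization.AtPrime 𝔔.asIdeal) ∧ ∀ dd : ℕ, ringKrullDim (Localization.AtPrime 𝔔.asIdeal) = dd →
            ∀ s : Fin dd → Localization.AtPrime 𝔔.asIdeal, (Ideal.span (Set.range s)).radical.IsMaximal →
              RingTheory.Sequence.IsWeaklyRegular (Localization.AtPrime 𝔔.asIdeal) (List.ofFn s) ∧
              ∀ y : Localization.AtPrime 𝔔.asIdeal, (∃ e : ℕ, y ^ 5 ^ e ∈ Ideal.span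
                ((fun z : Localization.AtPrime 𝔔.asIdeal => z ^ 5 ^ e) '' (Ideal.span (Set.range s) : Set (Localization.AtPrime 𝔔.asIdeal)))) →
                y ∈ Ideal.span (Set.range s) := by
  haveI : Fact (Nat.Prime 5) := ⟨by norm_num⟩
  -- `Gs = ![T₁₁]` (a `Fin 1`-vector is determined by its value at `0`), then substitute
  have e : Gs = ![X 2 ^ 2 + (X 1 ^ 2 + X 0 ^ 3) ^ 3 + X 0 ^ 11 + X 3 ^ 7] := by
    funext l
    fin_cases l
    exact hG
  subst e
  have hpr := T11HypersurfacePrime.t11_prime_and_X_ne_zero k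
    (![X 2 ^ 2 + (X 1 ^ 2 + X 0 ^ 3) ^ 3 + X 0 ^ 11 + X 3 ^ 7] : Fin 1 → MvPolynomial (Fin 4) k) rfl
  have hf0 : constantCoeff (X 2 ^ 2 + (X 1 ^ 2 + X 0 ^ 3) ^ 3 + X 0 ^ 11 + X 3 ^ 7 : MvPolynomial (Fin 4) k) = 0 := by
    simp [constantCoeff_X]
  exact RoadBFrame.originPointFixable_of_cells 5 k 4 87 T11Char7Fan.ht T11Char7Fan.A T11Char7Fan.hAJ T11Char7Fan.hprim
    T11Char7Fan.m (T11Char7Fan.hcov k) T11Char7Fan.V T11Char7Fan.hV T11Char7Fan.a T11Char7Fan.haA T11Char7Fan.hgen T11Char7Fan.hge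
    (X 2 ^ 2 + (X 1 ^ 2 + X 0 ^ 3) ^ 3 + X 0 ^ 11 + X 3 ^ 7) hf0 hpr.1 hpr.2 T11Char7Poly.G T11Char7Fan.d (T11Char7Poly.hθF₀ k)
    T11Char7Fan.hunit (T11Char7Fan.hzero k _) (T11Char5Poly.hg0 k) (T11Char5Poly.hX k) T11Char7Poly.SS T11Char7Poly.hSScov
    (cells_all k)

/-- **THE CRUX STATEMENT FOR `X = T₁₁⁺` OVER EVERY FIELD OF CHARACTERISTIC `5`, UNCONDITIONAL** (the second prime for the deciding
specimen, after stub-1's `T11OriginPointFixableChar7.fInjectiveMacaulayfication_T11plus_char7`). `T₁₁⁺ = V(Φ − y² − x³, z² + Φ³ + x¹¹ + w⁷) ⊂ 𝔸⁵_k`,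
`char k = 5`, HAS AN F-INJECTIVE MACAULAYFICATION in the sense of the crux `FrobeniusLadder.FInjectiveMacaulayfication`: a proper birational
`π : X' → X` with every stalk of `X'` a domain in which every system of parameters is weakly regular and generates a Frobenius-closed ideal.
Assembly: the generic-characteristic specimen door `T11SpecimenDoorGeneric.fInjectiveMacaulayfication_T11plus_char5_of_h0` (regular off the
origin at `p = 5`), fed by the stalk transport `T11PlusOriginTransportStalk.t11Plus_h0_of_hypersurface_h0 (p := 5)` applied to
`t11_originPointFixable_char5`. [OURS · L1 W4.5a; AI-built, weaker than expert review; no statement of the manuscript is used; the certificate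
mathematics is res-L1-w45a-tri-1's] -/
theorem fInjectiveMacaulayfication_T11plus_char5 (k : Type) [Field k] [CharP k 5] (Fs : Fin 2 → MvPolynomial (Fin 5) k)
    (hF₀ : Fs 0 = X 4 - X 1 ^ 2 - X 0 ^ 3) (hF₁ : Fs 1 = X 2 ^ 2 + X 4 ^ 3 + X 0 ^ 11 + X 3 ^ 7) :
    ∃ (X' : Scheme.{0}) (π : X' ⟶ (Spec (.of (MvPolynomial (Fin 5) k ⧸ Ideal.span (Set.range Fs))))),
      IsProper π ∧ Literature.AlgebraicGeometry.Resolution.IsBirational π ∧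
      ∀ x : X', IsDomain (X'.presheaf.stalk x) ∧ ∀ d : ℕ, ringKrullDim (X'.presheaf.stalk x) = d →
        ∀ s : Fin d → X'.presheaf.stalk x, (Ideal.span (Set.range s)).radical.IsMaximal →
          RingTheory.Sequence.IsWeaklyRegular (X'.presheaf.stalk x) (List.ofFn s) ∧
          ∀ y : X'.presheaf.stalk x, (∃ e : ℕ, y ^ 5 ^ e ∈ Ideal.span
            ((fun z : X'.presheaf.stalk x => z ^ 5 ^ e) '' (Ideal.span (Set.range s) : Set (X'.presheaf.stalk x)))) →
            y ∈ Ideal.span (Set.range s) := by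
  haveI : (Ideal.span (Set.range fun j : Fin 4 => Ideal.Quotient.mk (Ideal.span (Set.range
      (![X 2 ^ 2 + (X 1 ^ 2 + X 0 ^ 3) ^ 3 + X 0 ^ 11 + X 3 ^ 7] : Fin 1 → MvPolynomial (Fin 4) k))) (MvPolynomial.X j))).IsPrime :=
    (QuotientOriginMaximal.isMaximal_span_range_mk_X k
      (![X 2 ^ 2 + (X 1 ^ 2 + X 0 ^ 3) ^ 3 + X 0 ^ 11 + X 3 ^ 7] : Fin 1 → MvPolynomial (Fin 4) k)
      (fun l => by fin_cases l; simp [constantCoeff_X])).isPrime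
  exact T11SpecimenDoorGeneric.fInjectiveMacaulayfication_T11plus_char5_of_h0 k Fs hF₀ hF₁
    (T11PlusOriginTransportStalk.t11Plus_h0_of_hypersurface_h0 k 5 Fs hF₀ hF₁
      (![X 2 ^ 2 + (X 1 ^ 2 + X 0 ^ 3) ^ 3 + X 0 ^ 11 + X 3 ^ 7] : Fin 1 → MvPolynomial (Fin 4) k) rfl
      (t11_originPointFixable_char5 k _ rfl))

end Summit.ResolutionOfSingularities.ResolutionOfSingularities.Theorems.FInjectiveMacaulayfication.T11OriginPointFixableChar5

end

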